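import Summits.Parity.BatemanHorn.Theorems.SelbergDelangeRigidityLSDRealSegmentTailsTwoRankinPrep
import HarnessLib

/-!
# Route `SelbergDelangeRigidity`, crux `LSDRealSegment` (stmt-Parity-9770), line
# `product-anatomy-subcritical`: ingredients of clauses (c), (d) of `stub_tailsTwo` (the top weight)

In the top class (`fᵢ(n)` has a prime factor `p > x^{dᵢ−η}`) the value is `fᵢ(n) = m · p` with `m < w = H x^η < p`:
its `w`-smooth part is `m` and its `w`-rough part is ONE prime.  The engine weight recording this is the TOP WEIGHT
`F(N) = y^{Ω(smoothPart w r)} · 1[Ω(roughPart w r) ≤ R₀]`, `r = roughPart P N` (`R₀ = 1`; `R₀ = 2` for two balanced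
primes in one quadratic value): it lies in `𝓜(y, 1, ε)` once `P^ε ≥ y` (`tailsTwo_topWeight_isClassM`, registered
helper), depends only on the `P`-rough part, is `1` at `1`, and is dominated by `y^{Ω(smoothPart w N)} 1[Ω(roughPart w N) ≤ R₀]`
(`P ≤ w`), whose harmonic sum FACTORS as (smooth part) × (rough part with `Ω ≤ R₀`): the first factor is `≪ (log w)^y`
(`harmonic_smooth`), the second is `≤ 1 + C Σ_{w<p≤N} 1/p` for `R₀ = 1`.
-/

open Filter Finset Polynomial
open scoped BigOperators Topology Classical

namespace Summit.Parity.BatemanHorn.Cruxes.LSDRealSegment.ProductAnatomySubcritical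

open Literature.NumberTheory.Sieve
open ArithmeticFunction (cardFactors)
noncomputable section

variable {k : ℕ}

/-! ### Smooth and rough parts at two cuts `P ≤ w` -/

/-- For `P ≤ w` the `w`-rough part of the `P`-rough part is the `w`-rough part. [folklore] -/
theorem roughPart_roughPart_of_le {P w : ℝ} (hPw : P ≤ w) (m : ℕ) : roughPart w (roughPart P m) = roughPart w m := by
  refine Nat.eq_of_factorization_eq (roughPart_ne_zero _ _) (roughPart_ne_zero _ _) fun p => ?_
  rw [factorization_roughPart, factorization_roughPart, factorization_roughPart]
  by_cases h1 : (p : ℝ) ≤ w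
  · rw [if_pos h1, if_pos h1]
  · rw [if_neg h1, if_neg h1, if_neg (fun h => h1 (h.trans hPw))]

/-- The `w`-smooth part of the `P`-rough part divides the `w`-smooth part. [folklore] -/
theorem smoothPart_roughPart_dvd (P w : ℝ) (m : ℕ) : smoothPart w (roughPart P m) ∣ smoothPart w m := by
  rcases eq_or_ne m 0 with rfl | hm
  · simp [roughPart]
  · exact smoothPart_dvd_smoothPart w (roughPart_dvd P m) hm

/-- A `w`-rough `b ≥ 1` with `Ω(b) ≤ 1` is `1` or a prime `> w`. [folklore] -/
theorem eq_one_or_prime_of_cardFactors_le_one {w : ℝ} {b : ℕ} (hb : b ≠ 0) (hrough : ∀ p ∈ b.primeFactors, w < (p : ℝ))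
    (hΩ : cardFactors b ≤ 1) : b = 1 ∨ (b.Prime ∧ w < (b : ℝ)) := by
  rcases Nat.lt_or_ge (cardFactors b) 1 with h | h
  · left
    have h0 : cardFactors b = 0 := by omega
    rw [ArithmeticFunction.cardFactors_apply, List.length_eq_zero_iff, Nat.primeFactorsList_eq_nil] at h0
    omega
  · right
    have h1 : cardFactors b = 1 := le_antisymm hΩ h
    rw [ArithmeticFunction.cardFactors_eq_one_iff_prime] at h1
    exact ⟨h1, hrough b (Nat.mem_primeFactors.mpr ⟨h1, dvd_rfl, hb⟩)⟩

/-! ### The top weight -/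

section TopWeight

variable {y ε w : ℝ} {P R₀ : ℕ}

/-- **tailsTwo_topWeight_isClassM** (registered helper of `stub_tailsTwo`, line `product-anatomy-subcritical`): the top
weight `N ↦ y^{Ω(smoothPart w r)} · 1[Ω(roughPart w r) ≤ R₀]`, `r = roughPart P N`, is of class `𝓜(y, 1, ε)` whenever
`1 ≤ y ≤ P^ε` (`P ≥ 1`): it is sub-multiplicative in the required sense (`Ω` of rough parts adds up), `≤ y^{Ω(m)}`, and
`≤ r^ε ≤ m^ε` on the factor `m`; it depends only on the `P`-rough part and equals `1` at `1`. [folklore] -/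
theorem tailsTwo_topWeight_isClassM : ∀ (y ε w : ℝ) (P R₀ : ℕ), 1 ≤ y → 0 < ε → 1 ≤ P → y ≤ (P : ℝ) ^ ε →
    IsClassM y 1 ε (fun N => y ^ cardFactors (smoothPart w (roughPart (P : ℝ) N)) *
      (if cardFactors (roughPart w (roughPart (P : ℝ) N)) ≤ R₀ then 1 else 0)) ∧
    (∀ N, y ^ cardFactors (smoothPart w (roughPart (P : ℝ) N)) *
        (if cardFactors (roughPart w (roughPart (P : ℝ) N)) ≤ R₀ then (1 : ℝ) else 0) =
      y ^ cardFactors (smoothPart w (roughPart (P : ℝ) (roughPart (P : ℝ) N))) *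
        (if cardFactors (roughPart w (roughPart (P : ℝ) (roughPart (P : ℝ) N))) ≤ R₀ then 1 else 0)) ∧
    y ^ cardFactors (smoothPart w (roughPart (P : ℝ) 1)) *
        (if cardFactors (roughPart w (roughPart (P : ℝ) 1)) ≤ R₀ then (1 : ℝ) else 0) ≤ 1 := by
  intro y ε w P R₀ hy hε hP hyP
  have hy0 : 0 ≤ y := by linarith
  have hP0 : (0 : ℝ) ≤ P := Nat.cast_nonneg P
  set F : ℕ → ℝ := fun N => y ^ cardFactors (smoothPart w (roughPart (P : ℝ) N)) *
    (if cardFactors (roughPart w (roughPart (P : ℝ) N)) ≤ R₀ then 1 else 0) with hF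
  have hF0 : ∀ N, 0 ≤ F N := fun N => by simp only [hF]; split_ifs <;> positivity
  refine ⟨⟨hF0, fun m n hm hn hmn => ?_⟩, fun N => by rw [roughPart_roughPart], by simp [roughPart]⟩
  have hm0 : m ≠ 0 := by omega
  have hn0 : n ≠ 0 := by omega
  set rm := roughPart (P : ℝ) m with hrm
  set rn := roughPart (P : ℝ) n with hrn
  have hrm0 : rm ≠ 0 := roughPart_ne_zero _ _
  have hrn0 : rn ≠ 0 := roughPart_ne_zero _ _
  -- `F(mn) ≤ y^{Ω(smoothPart w rm)} F(n)`
  have hsub : F (m * n) ≤ y ^ cardFactors (smoothPart w rm) * F n := by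
    show y ^ cardFactors (smoothPart w (roughPart (P : ℝ) (m * n))) *
        (if cardFactors (roughPart w (roughPart (P : ℝ) (m * n))) ≤ R₀ then (1 : ℝ) else 0) ≤
      y ^ cardFactors (smoothPart w rm) * (y ^ cardFactors (smoothPart w rn) *
        (if cardFactors (roughPart w rn) ≤ R₀ then (1 : ℝ) else 0))
    rw [roughPart_mul _ hm0 hn0, smoothPart_mul w hrm0 hrn0, roughPart_mul w hrm0 hrn0,
      ArithmeticFunction.cardFactors_mul (smoothPart_ne_zero _ _) (smoothPart_ne_zero _ _),
      ArithmeticFunction.cardFactors_mul (roughPart_ne_zero _ _) (roughPart_ne_zero _ _), pow_add, mul_assoc]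
    refine mul_le_mul_of_nonneg_left (mul_le_mul_of_nonneg_left ?_ (by positivity)) (by positivity)
    split_ifs with h1 h2
    · exact le_rfl
    · exact absurd (le_trans (Nat.le_add_left _ _) h1) h2
    · exact zero_le_one
    · exact le_rfl
  refine hsub.trans (mul_le_mul_of_nonneg_right (le_min ?_ ?_) (hF0 n))
  · -- `≤ y^{Ω(m)}`
    refine pow_le_pow_right₀ hy ?_
    · calc cardFactors (smoothPart w rm) ≤ cardFactors rm := by
            conv_rhs => rw [← smoothPart_mul_roughPart w hrm0]
            rw [ArithmeticFunction.cardFactors_mul (smoothPart_ne_zero _ _) (roughPart_ne_zero _ _)]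
            exact Nat.le_add_right _ _
        _ ≤ cardFactors m := by rw [hrm, roughPart_eq_div _ hm0]; exact cardFactors_div_smoothPart_le _ hm0
  · -- `≤ m^ε`
    rw [one_mul]
    have hrm_le : (rm : ℝ) ≤ m := by exact_mod_cast Nat.le_of_dvd (by omega) (roughPart_dvd _ m)
    calc y ^ cardFactors (smoothPart w rm) ≤ y ^ cardFactors rm := by
          refine pow_le_pow_right₀ hy ?_
          conv_rhs => rw [← smoothPart_mul_roughPart w hrm0]
          rw [ArithmeticFunction.cardFactors_mul (smoothPart_ne_zero _ _) (roughPart_ne_zero _ _)]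
          exact Nat.le_add_right _ _
      _ ≤ ((P : ℝ) ^ ε) ^ cardFactors rm := pow_le_pow_left₀ hy0 hyP _
      _ = ((P : ℝ) ^ cardFactors rm) ^ ε := by
          rw [← Real.rpow_natCast, ← Real.rpow_mul hP0, mul_comm, Real.rpow_mul hP0, Real.rpow_natCast]
      _ ≤ (rm : ℝ) ^ ε := Real.rpow_le_rpow (by positivity)
          (pow_cardFactors_le_self hP0 hrm0 fun q hq hqr => (lt_of_mem_primeFactors_roughPart
            (Nat.mem_primeFactors.mpr ⟨hq, hqr, hrm0⟩)).le) hε.le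
      _ ≤ ((m : ℕ) : ℝ) ^ ε := Real.rpow_le_rpow (by positivity) hrm_le hε.le

/-- The top weight is dominated by the un-peeled top tilt `y^{Ω(smoothPart w N)} 1[Ω(roughPart w N) ≤ R₀]` when `P ≤ w`. [folklore] -/
theorem topWeight_le (hy : 1 ≤ y) (hPw : (P : ℝ) ≤ w) (N : ℕ) :
    y ^ cardFactors (smoothPart w (roughPart (P : ℝ) N)) *
        (if cardFactors (roughPart w (roughPart (P : ℝ) N)) ≤ R₀ then (1 : ℝ) else 0) ≤
      y ^ cardFactors (smoothPart w N) * (if cardFactors (roughPart w N) ≤ R₀ then (1 : ℝ) else 0) := by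
  rw [roughPart_roughPart_of_le hPw]
  refine mul_le_mul_of_nonneg_right (pow_le_pow_right₀ hy ?_) (by split_ifs <;> norm_num)
  rcases eq_or_ne N 0 with rfl | hN
  · simp [roughPart]
  have hdvd := smoothPart_roughPart_dvd (P : ℝ) w N
  obtain ⟨c, hc⟩ := hdvd
  have hc0 : c ≠ 0 := fun h => smoothPart_ne_zero w N (by rw [hc, h, mul_zero])
  rw [hc, ArithmeticFunction.cardFactors_mul (smoothPart_ne_zero _ _) hc0]
  exact Nat.le_add_right _ _

end TopWeight

/-! ### The harmonic sum of the top tilt factors -/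

/-- **Factorisation of the top harmonic sum**: `Σ_{m ≤ N} y^{Ω(smoothPart w m)} 1[Ω(roughPart w m) ≤ R₀] ρ(m)/m` is at most
the product of the `w`-smooth harmonic sum and the sum of `ρ(b)/b` over the `w`-rough `b ≤ N` with `Ω(b) ≤ R₀`
(`m ↦ (smoothPart w m, roughPart w m)` is injective and `ρ` is multiplicative). [folklore] -/
theorem topHarmonic_le_mul (g : ℤ[X]) {y : ℝ} (hy : 0 ≤ y) (w : ℝ) (R₀ N : ℕ) :
    ∑ m ∈ Finset.Icc 1 N, y ^ cardFactors (smoothPart w m) * (if cardFactors (roughPart w m) ≤ R₀ then (1 : ℝ) else 0) *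
        (polyRootCountMod ![g] m : ℝ) / m ≤
      (∑ a ∈ (Finset.Icc 1 N).filter (fun a : ℕ => ∀ p ∈ a.primeFactors, (p : ℝ) ≤ w),
          y ^ cardFactors a * (polyRootCountMod ![g] a : ℝ) / a) *
        ∑ b ∈ (Finset.Icc 1 N).filter (fun b : ℕ => (∀ p ∈ b.primeFactors, w < (p : ℝ)) ∧ cardFactors b ≤ R₀),
          (polyRootCountMod ![g] b : ℝ) / b := by
  set A := (Finset.Icc 1 N).filter (fun a : ℕ => ∀ p ∈ a.primeFactors, (p : ℝ) ≤ w) with hA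
  set B := (Finset.Icc 1 N).filter (fun b : ℕ => (∀ p ∈ b.primeFactors, w < (p : ℝ)) ∧ cardFactors b ≤ R₀) with hB
  set h : ℕ × ℕ → ℝ := fun ab => (y ^ cardFactors ab.1 * (polyRootCountMod ![g] ab.1 : ℝ) / ab.1) *
    ((polyRootCountMod ![g] ab.2 : ℝ) / ab.2) with hh
  have hh0 : ∀ ab, 0 ≤ h ab := fun ab => by positivity
  rw [Finset.sum_mul_sum, ← Finset.sum_product']
  -- drop the terms with `Ω(roughPart) > R₀` and re-index the rest through `m ↦ (smoothPart w m, roughPart w m)`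
  set S := (Finset.Icc 1 N).filter (fun m : ℕ => cardFactors (roughPart w m) ≤ R₀) with hS
  have hdrop : ∑ m ∈ Finset.Icc 1 N, y ^ cardFactors (smoothPart w m) * (if cardFactors (roughPart w m) ≤ R₀ then (1 : ℝ) else 0) *
      (polyRootCountMod ![g] m : ℝ) / m = ∑ m ∈ S, h (smoothPart w m, roughPart w m) := by
    rw [hS, Finset.sum_filter]
    refine Finset.sum_congr rfl fun m hm => ?_
    have hm0 : m ≠ 0 := by have := (Finset.mem_Icc.mp hm).1; omega
    split_ifs with hc
    · simp only [hh, mul_one]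
      have hcop := coprime_smoothPart_roughPart w m
      have hprod := smoothPart_mul_roughPart w hm0
      conv_lhs => rw [show (polyRootCountMod ![g] m : ℝ) = polyRootCountMod ![g] (smoothPart w m * roughPart w m) by rw [hprod],
        polyRootCountMod_mul_of_coprime_system _ hcop, show ((m : ℕ) : ℝ) = ((smoothPart w m * roughPart w m : ℕ) : ℝ) by rw [hprod]]
      push_cast
      have h1 : (smoothPart w m : ℝ) ≠ 0 := by exact_mod_cast smoothPart_ne_zero w m
      have h2 : (roughPart w m : ℝ) ≠ 0 := by exact_mod_cast roughPart_ne_zero w m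
      field_simp
    · simp
  rw [hdrop]
  have hinj : Set.InjOn (fun m => (smoothPart w m, roughPart w m)) S := by
    intro m hm m' hm' heq
    simp only [Prod.mk.injEq] at heq
    have hm0 : m ≠ 0 := by have := (Finset.mem_Icc.mp (Finset.mem_filter.mp hm).1).1; omega
    have hm0' : m' ≠ 0 := by have := (Finset.mem_Icc.mp (Finset.mem_filter.mp hm').1).1; omega
    rw [← smoothPart_mul_roughPart w hm0, ← smoothPart_mul_roughPart w hm0', heq.1, heq.2]
  rw [← Finset.sum_image hinj]
  refine Finset.sum_le_sum_of_subset_of_nonneg (fun ab hab => ?_) fun ab _ _ => hh0 ab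
  rw [Finset.mem_image] at hab
  obtain ⟨m, hm, rfl⟩ := hab
  rw [hS, Finset.mem_filter, Finset.mem_Icc] at hm
  have hm0 : m ≠ 0 := by omega
  rw [Finset.mem_product, hA, hB, Finset.mem_filter, Finset.mem_filter, Finset.mem_Icc, Finset.mem_Icc]
  refine ⟨⟨⟨Nat.one_le_iff_ne_zero.mpr (smoothPart_ne_zero _ _), (smoothPart_le w hm0).trans hm.1.2⟩,
    fun p hp => le_of_mem_primeFactors_smoothPart hp⟩,
    ⟨⟨Nat.one_le_iff_ne_zero.mpr (roughPart_ne_zero _ _), (Nat.le_of_dvd (by omega) (roughPart_dvd w m)).trans hm.1.2⟩,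
    fun p hp => lt_of_mem_primeFactors_roughPart hp, hm.2⟩⟩

/-- **The rough factor for `R₀ = 1`**: `Σ_{b ≤ N, w-rough, Ω(b) ≤ 1} ρ(b)/b ≤ 1 + C Σ_{w < p ≤ N} 1/p` when `ρ(p) ≤ C`. [folklore] -/
theorem roughFactor_one_le (g : ℤ[X]) {C : ℕ} (hC : ∀ p : ℕ, p.Prime → polyRootCountMod ![g] p ≤ C) (w : ℝ) (N : ℕ) :
    ∑ b ∈ (Finset.Icc 1 N).filter (fun b : ℕ => (∀ p ∈ b.primeFactors, w < (p : ℝ)) ∧ cardFactors b ≤ 1),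
        (polyRootCountMod ![g] b : ℝ) / b ≤ 1 + C * ∑ p ∈ (Nat.primesLE N).filter (fun p : ℕ => w < (p : ℝ)), (1 : ℝ) / p := by
  have hsub : (Finset.Icc 1 N).filter (fun b : ℕ => (∀ p ∈ b.primeFactors, w < (p : ℝ)) ∧ cardFactors b ≤ 1) ⊆
      insert 1 ((Nat.primesLE N).filter (fun p : ℕ => w < (p : ℝ))) := by
    intro b hb
    rw [Finset.mem_filter, Finset.mem_Icc] at hb
    rcases eq_one_or_prime_of_cardFactors_le_one (by omega) hb.2.1 hb.2.2 with rfl | ⟨hp, hwb⟩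
    · exact Finset.mem_insert_self _ _
    · exact Finset.mem_insert_of_mem (Finset.mem_filter.mpr ⟨Nat.mem_primesLE.mpr ⟨hb.1.2, hp⟩, hwb⟩)
  refine (Finset.sum_le_sum_of_subset_of_nonneg hsub fun b _ _ => by positivity).trans ?_
  rw [Finset.sum_insert (fun h => by
    have := Nat.prime_of_mem_primesLE (Finset.mem_filter.mp h).1
    exact Nat.not_prime_one this), polyRootCountMod_one, Nat.cast_one, div_one, Finset.mul_sum]
  refine add_le_add le_rfl (Finset.sum_le_sum fun p hp => ?_)
  have hp' := Nat.prime_of_mem_primesLE (Finset.mem_filter.mp hp).1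
  rw [mul_one_div]
  exact div_le_div_of_nonneg_right (by exact_mod_cast hC p hp') (Nat.cast_nonneg _)

end

end Summit.Parity.BatemanHorn.Cruxes.LSDRealSegment.ProductAnatomySubcritical
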